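import Literature.AnabelianGeometry.Anabelioids.ComponentsOfObjects
import Literature.AnabelianGeometry.Anabelioids.ProSigmaProofs

/-!
# Subobjects of an object of a connected anabelioid are determined by their fibres

[SGA1, Exp. V §4–5] (the fibre functor of a Galois category is conservative and `X ↦ F(X)`
identifies subobjects of `X` with `π₁`-stable subsets of `F(X)`); used by Mochizuki, *Semi-graphs
of anabelioids*, Publ. RIMS **42** (2006), §2 p. 23 [cite: MochizukiSemiAnbd2006, Def. 2.2(i)
p.23], where the finite étale covering attached to `A ∈ B(𝒢)` is read off from the connected
components of the constituents `S_v`, `T_e` and sub-objects of `A` are assembled from unions of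
components.  This proof-only file records the three fibre-level tools that assembly needs:

* `range_map_sigmaDesc` — the fibre-image of `∐ Yⱼ → X` is the union of the fibre-images;
* `mono_sigmaDesc_of_pairwise_disjoint` — monomorphisms `Yⱼ ↪ X` with pairwise disjoint
  fibre-images assemble to a MONOMORPHISM `∐ Yⱼ ↪ X`;
* `exists_iso_of_range_eq` — two monomorphisms into `X` with the same fibre-image are isomorphic
  over `X` (via abc-iut-L3's `subobject_le_of_range_subset`).
-/

namespace Literature.AnabelianGeometry.Anabelioids

open CategoryTheory CategoryTheory.Limits CategoryTheory.PreGaloisCategory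

universe w v₁ u₁

variable {C : Type u₁} [Category.{v₁} C] [GaloisCategory C] (F : C ⥤ FintypeCat.{w})
  [FiberFunctor F]

/-- The fibre-image of a map out of a finite coproduct is the union of the fibre-images of its
components (the fibre functor preserves finite coproducts). [cite: SGA1, Exp. V §4 (condition (G5))] -/
theorem range_map_sigmaDesc {J : Type} [Finite J] {Y : J → C} {X : C} (f : ∀ j, Y j ⟶ X) :
    Set.range (F.map (Sigma.desc f)) = ⋃ j, Set.range (F.map (f j)) := by
  ext x
  simp only [Set.mem_range, Set.mem_iUnion]
  constructor
  · rintro ⟨z, rfl⟩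
    obtain ⟨⟨j⟩, y, rfl⟩ := fiber_jointly_surjective F (colimit.cocone (Discrete.functor Y))
      (colimit.isColimit _) z
    refine ⟨j, y, ?_⟩
    change F.map (f j) y = F.map (Sigma.desc f) (F.map (Sigma.ι Y j) y)
    rw [← FintypeCat.comp_apply, ← F.map_comp, Sigma.ι_desc]
  · rintro ⟨j, y, rfl⟩
    exact ⟨F.map (Sigma.ι Y j) y, by rw [← FintypeCat.comp_apply, ← F.map_comp, Sigma.ι_desc]⟩

/-- **Disjoint monomorphisms assemble to a monomorphism**: if the `fⱼ : Yⱼ ↪ X` are monomorphisms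
with pairwise disjoint fibre-images, then `∐ Yⱼ → X` is a monomorphism (its fibre map is
injective). [cite: SGA1, Exp. V §4 (condition (G5))] -/
theorem mono_sigmaDesc_of_pairwise_disjoint {J : Type} [Finite J] {Y : J → C} {X : C}
    (f : ∀ j, Y j ⟶ X) [∀ j, Mono (f j)]
    (hdisj : Pairwise fun j j' => Disjoint (Set.range (F.map (f j))) (Set.range (F.map (f j')))) :
    Mono (Sigma.desc f) := by
  have hinj : Function.Injective (F.map (Sigma.desc f)) := by
    intro z₁ z₂ h
    obtain ⟨⟨j₁⟩, y₁, rfl⟩ := fiber_jointly_surjective F (colimit.cocone (Discrete.functor Y))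
      (colimit.isColimit _) z₁
    obtain ⟨⟨j₂⟩, y₂, rfl⟩ := fiber_jointly_surjective F (colimit.cocone (Discrete.functor Y))
      (colimit.isColimit _) z₂
    change F.map (Sigma.desc f) (F.map (Sigma.ι Y j₁) y₁) =
      F.map (Sigma.desc f) (F.map (Sigma.ι Y j₂) y₂) at h
    rw [← FintypeCat.comp_apply, ← F.map_comp, Sigma.ι_desc, ← FintypeCat.comp_apply,
      ← F.map_comp, Sigma.ι_desc] at h
    have hj : j₁ = j₂ := by
      by_contra hne
      exact Set.disjoint_left.mp (hdisj hne) ⟨y₁, rfl⟩ ⟨y₂, h.symm⟩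
    subst hj
    have hy : y₁ = y₂ := ConcreteCategory.injective_of_mono_of_preservesPullback (F.map (f j₁)) h
    subst hy
    rfl
  haveI : Mono (F.map (Sigma.desc f)) := ConcreteCategory.mono_of_injective _ hinj
  exact F.mono_of_mono_map this

omit [GaloisCategory C] [FiberFunctor F] in
/-- The fibre-image of a monomorphism is that of the subobject it defines. [cite: SGA1, Exp. V §4] -/
theorem range_map_mk_arrow {Y X : C} (f : Y ⟶ X) [Mono f] :
    Set.range (F.map (Subobject.mk f).arrow) = Set.range (F.map f) := by
  rw [← Subobject.underlyingIso_hom_comp_eq_mk, F.map_comp]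
  ext x
  constructor
  · rintro ⟨y, rfl⟩
    exact ⟨F.map (Subobject.underlyingIso f).hom y, rfl⟩
  · rintro ⟨y, rfl⟩
    refine ⟨F.map (Subobject.underlyingIso f).inv y, ?_⟩
    rw [FintypeCat.comp_apply, ← FintypeCat.comp_apply (F.map _) (F.map _) y, ← F.map_comp,
      Iso.inv_hom_id, F.map_id, FintypeCat.id_apply]

/-- **Monomorphisms with the same fibre-image are isomorphic over the base.**
[cite: SGA1, Exp. V §4] -/
theorem exists_iso_of_range_eq {Y Z X : C} (f : Y ⟶ X) (g : Z ⟶ X) [Mono f] [Mono g]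
    (h : Set.range (F.map f) = Set.range (F.map g)) : ∃ e : Y ≅ Z, e.hom ≫ g = f := by
  have hle : Subobject.mk f ≤ Subobject.mk g :=
    subobject_le_of_range_subset F _ _ (by rw [range_map_mk_arrow, range_map_mk_arrow, h])
  have hge : Subobject.mk g ≤ Subobject.mk f :=
    subobject_le_of_range_subset F _ _ (by rw [range_map_mk_arrow, range_map_mk_arrow, h])
  exact ⟨Subobject.isoOfMkEqMk f g (le_antisymm hle hge), by
    rw [Subobject.isoOfMkEqMk_hom, Subobject.ofMkLEMk_comp]⟩

/-- The fibre-image of a monomorphism out of a non-initial object is nonempty. [cite: SGA1, Exp. V §4] -/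
theorem range_nonempty_of_not_isInitial {Y X : C} (f : Y ⟶ X) (hY : IsInitial Y → False) :
    (Set.range (F.map f)).Nonempty := by
  obtain ⟨y⟩ := (not_initial_iff_fiber_nonempty F Y).mp hY
  exact ⟨F.map f y, y, rfl⟩

end Literature.AnabelianGeometry.Anabelioids
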